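import Summits.BirchSwinnertonDyer.BirchSwinnertonDyer.Theorems.SylvesterTwoHeegnerIndexUpperOnV0
import HarnessLib

/-!
# Rung leaf K7t `X12.CMAtTwo` (`BSD(E_p, 2)` on 𝒞_HSY) ⟺ the `2`-ADIC PAIR IDENTITY
# `ord₂ (#Ш(E_p)·#Ш(E_{3p²})) = ord₂ (#Ш_an(E_p)·#Ш_an(E_{3p²}))` (binder-free), and the rung from the
# two registered stubs of crux 19476 + the lower twin 19477 (composition)

HONEST FRAMING (cell «bsd-cm», D-0074 seat `bsd-cm-k7t-c2` gen 2; route `SylvesterTwoHeegnerIndex`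
rev 7, items 19476 `HeegnerIndexUpperAtTwoHSYOfFacts` / 19477 `HeegnerIndexLowerAtTwoHSYOfFacts`).
The rung leaf `X12.CMAtTwo` is OPEN and stays open; this file proves no case of it. It records,
sorry-free and over the route's own support item `PublishedFactsTwo` (19231):

* `bsdp_two_iff_pairIdentity` — per member `B ≅ E_p` and partner `A ≅ E_{3p²}` (both globally
  minimal): `BSDp B 2 ⟺ ord₂ #Ш(B)[2^∞] + ord₂ #Ш(A)[2^∞] = ord₂ (#Ш_an(B)·#Ш_an(A))` — Miller's
  `BSD(E_p, 2)` is the `2`-adic identity for Hu–Shu–Yin's PRODUCT (their display (bsd1)/(bsd), p. 12: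
  `|Ш(E_p)|·|Ш(E_{3p²})| = 2^i ĥ(R)/ĥ(P)` as the BSD prediction), the partner's own `BSD(A, 2)` being
  Burungale–Flach 2024;
* **`cmAtTwo_iff_pairIdentity`** — granted the facts, the RUNG LEAF ⟺ the pair identity for every
  member and every minimal partner model (binder-free);
* `cmAtTwo_iff_indexIdentity_of_twoAdicPair` — under the cell's displayed `2`-adic index theorem
  `hBC` (memo two Thm B′/B″ + C, see `…UpperOnV0.lean`): the leaf ⟺ `ord₂ #Ш(E_p)[2^∞] +
  ord₂ #Ш(E_{3p²})[2^∞] = 2 n(p)` — the Gross–Zagier–Kolyvagin INDEX FORMULA for the pair at `2`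
  (memo two Thm B′: `r(p)² = 2^{−i} #Ш(E_p)·#Ш(E_{3p²})`), both halves;
* `cmAtTwo_of_stubs_of_lowerOfFacts` — COMPOSITION: the two registered stubs of 19476
  (`stub_twoAdicPairHSY` = `hBC`, `stub_indexBoundOffV0HSY` = `hoff`) + the lower twin 19477 + the
  facts give the leaf (via `CMRungInputs.cmAtTwo_of_inputs`, the route's bridge). Conditional by
  construction; credits nothing.

WHAT THIS IS NOT: not a proof of `BSD(E_p, 2)` for any `p`; nothing booked. References:
[HuShuYin2019] (bsd1), (bsd) p. 12, Cor. 4.4; [BurungaleFlach2024] Thm 1.1, Cor. 2; [Miller2011LMS]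
Def. 1.1; parents `…UpperPairForm.lean` (p431591), `…UpperOnV0.lean` (p431798), `…LowerHalfContent.lean`
(p417655), `Theorems/CMRungInputs.lean` (p406906).
-/

set_option autoImplicit false
set_option linter.dupNamespace false

noncomputable section

open scoped Classical

open WeierstrassCurve NumberField Literature.NumberTheory.EllipticCurves
  Literature.NumberTheory.EllipticCurves.Rank1Residual
  Literature.NumberTheory.EllipticCurves.Rank1Residual.Typed
  Literature.NumberTheory.EllipticCurves.HuShuYin2019
  Summit.BirchSwinnertonDyer.Rank1Residual
  Summit.BirchSwinnertonDyer.BirchSwinnertonDyer.Theses.SylvesterTwoHeegnerIndex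

namespace Summit.BirchSwinnertonDyer.BirchSwinnertonDyer.Theorems.SylvesterTwoUpper

/-- **`BSD(E_p, 2)` at a member ⟺ the `2`-adic PAIR IDENTITY.** For globally minimal `B ≅ E_p`,
`A ≅ E_{3p²}` (`p` in 𝒞_HSY), granted Hu–Shu–Yin (`r_an(B) = 1`, `Ш(B)` finite), GZK (rank part),
Burungale–Flach and modularity: `BSDp B 2 ⟺ ord₂ #Ш(B)[2^∞] + ord₂ #Ш(A)[2^∞] = ord₂ (#Ш_an(B)·#Ш_an(A))`.
(`BSDp B 2 ⟺ MissingPPartAt B 2 ⟺` both halves; each half is its pair inequality, p431591.)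
[cite: HuShuYin2019, (bsd1) and (bsd) p. 12] [cite: BurungaleFlach2024, Thm. 1.1 and Cor. 2]
[cite: Miller2011LMS, Def. 1.1] -/
theorem bsdp_two_iff_pairIdentity (hHSY : thm14_threePart_product)
    (hCM0 : bsdTriple_of_hasCM_of_L_one_ne_zero) (hmod : hasEntireLFunction_rat)
    (hGZK : rank_eq_analyticRank_of_analyticRank_le_one)
    {p : ℕ} (hp : p.Prime) (h9 : p % 9 = 4 ∨ p % 9 = 7) (h3 : ¬ ∃ x : ZMod p, x ^ 3 = 3)
    (A B : WeierstrassCurve ℚ) [A.IsElliptic] [A.IsGloballyMinimal] [B.IsElliptic]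
    [B.IsGloballyMinimal] (hB : ∃ C : VariableChange ℚ, C • B = cubeSumCurve (p : ℚ))
    (hA : ∃ C : VariableChange ℚ, C • A = cubeSumCurve (3 * (p : ℚ) ^ 2)) :
    BSDp B 2 ↔
      ∃ qB qA : ℚ, shaAn B = (qB : ℂ) ∧ shaAn A = (qA : ℂ) ∧ qB * qA ≠ 0 ∧
        (padicValNat 2 (Nat.card (AddCommGroup.primaryComponent B.sha 2)) : ℤ) +
            (padicValNat 2 (Nat.card (AddCommGroup.primaryComponent A.sha 2)) : ℤ) =
          padicValRat 2 (qB * qA) := by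
  haveI : Fact (2 : ℕ).Prime := ⟨Nat.prime_two⟩
  obtain ⟨-, hrB, hfinB, -⟩ := hHSY p hp h9 h3 A B hB hA
  haveI : Finite B.sha := hfinB
  have hr : B.analyticRank ≤ 1 := by rw [hrB]
  constructor
  · intro hb
    obtain ⟨hlo, hup⟩ := lower_and_upper_of_missingPPartAt B 2 (missingPPartAt_of_bsdp B 2 hb)
    obtain ⟨qB, qA, hqB, hqA, hne, hle⟩ :=
      (missingUpperBoundAt_iff_pairBound hHSY hCM0 hmod hp h9 h3 A B hB hA).mp hup
    obtain ⟨qB', qA', hqB', hqA', -, hge⟩ :=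
      (missingLowerBoundAt_iff_pairBound hHSY hCM0 hmod hp h9 h3 A B hB hA).mp hlo
    have hqq : qB' = qB := by exact_mod_cast hqB'.symm.trans hqB
    have hqq' : qA' = qA := by exact_mod_cast hqA'.symm.trans hqA
    subst hqq hqq'
    exact ⟨qB', qA', hqB, hqA, hne, le_antisymm hle hge⟩
  · rintro ⟨qB, qA, hqB, hqA, hne, heq⟩
    exact bsdp_of_missingPPartAt B 2 hGZK hr (missingPPartAt_of_lower_of_upper B 2
      ((missingLowerBoundAt_iff_pairBound hHSY hCM0 hmod hp h9 h3 A B hB hA).mpr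
        ⟨qB, qA, hqB, hqA, hne, heq.symm.le⟩)
      ((missingUpperBoundAt_iff_pairBound hHSY hCM0 hmod hp h9 h3 A B hB hA).mpr
        ⟨qB, qA, hqB, hqA, hne, heq.le⟩))

/-- **THE RUNG LEAF ⟺ THE PAIR IDENTITY (binder-free).** Granted `PublishedFactsTwo`:
`X12.CMAtTwo` (`BSD(E_p, 2)` for every minimal model of every member of 𝒞_HSY) holds iff for all
members `B` and all minimal partners `A ≅ E_{3p²}`:
`ord₂ #Ш(B)[2^∞] + ord₂ #Ш(A)[2^∞] = ord₂ (#Ш_an(B)·#Ш_an(A))` — the `2`-part of Hu–Shu–Yin's display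
(bsd), whose odd part is their Thm 1.4 (at `3`) plus Kobayashi / Li–Liu–Tian (tree assembly
`X12/CubeSumSylvesterOddPart`). So rung K7t = «the `2`-adic valuation of ONE explicit Heegner-index
ratio `2^i ĥ(R)/ĥ(P)` equals that of `#Ш(E_p)·#Ш(E_{3p²})`». OPEN; nothing asserted.
[cite: HuShuYin2019, (bsd) p. 12 and Cor. 4.4] [cite: BurungaleFlach2024, Thm. 1.1 and Cor. 2]
[cite: Miller2011LMS, Def. 1.1] [cite: SilvermanAEC2009, VIII.8 Cor. 8.3] -/
theorem cmAtTwo_iff_pairIdentity (hF : PublishedFactsTwo) :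
    X12.CMAtTwo ↔
      ∀ (p : ℕ), p.Prime → (p % 9 = 4 ∨ p % 9 = 7) → (¬ ∃ x : ZMod p, x ^ 3 = 3) →
        ∀ (A B : WeierstrassCurve ℚ) [A.IsElliptic] [A.IsGloballyMinimal] [B.IsElliptic]
          [B.IsGloballyMinimal], (∃ C : VariableChange ℚ, C • B = cubeSumCurve (p : ℚ)) →
          (∃ C : VariableChange ℚ, C • A = cubeSumCurve (3 * (p : ℚ) ^ 2)) →
          ∃ qB qA : ℚ, shaAn B = (qB : ℂ) ∧ shaAn A = (qA : ℂ) ∧ qB * qA ≠ 0 ∧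
            (padicValNat 2 (Nat.card (AddCommGroup.primaryComponent B.sha 2)) : ℤ) +
                (padicValNat 2 (Nat.card (AddCommGroup.primaryComponent A.sha 2)) : ℤ) =
              padicValRat 2 (qB * qA) := by
  have hF' := hF
  obtain ⟨hHSY, hCM0, hmod, -, -, -, -, hGZK, -⟩ := hF'
  refine ⟨fun hleaf p hp h9 h3 A B _ _ _ _ hB hA => ?_, fun h p hp h9 h3 B _ _ hB => ?_⟩
  · exact (bsdp_two_iff_pairIdentity hHSY hCM0 hmod hGZK hp h9 h3 A B hB hA).mp
      (hleaf p hp h9 h3 B hB)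
  · have hn : (3 * (p : ℚ) ^ 2) ≠ 0 :=
      mul_ne_zero (by norm_num) (pow_ne_zero _ (Nat.cast_ne_zero.mpr hp.ne_zero))
    haveI := X12.CubeSumFamilies.isElliptic_cubeSumCurve hn
    obtain ⟨A, _, _, CA, hCA⟩ :=
      X12.CubeSumFamilies.exists_isGloballyMinimal_model (cubeSumCurve (3 * (p : ℚ) ^ 2))
    exact (bsdp_two_iff_pairIdentity hHSY hCM0 hmod hGZK hp h9 h3 A B hB ⟨CA, hCA⟩).mpr
      (h p hp h9 h3 A B hB ⟨CA, hCA⟩)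

section Binder

variable
  (hBC : ∀ (p : ℕ), p.Prime → (p % 9 = 4 ∨ p % 9 = 7) → (¬ ∃ x : ZMod p, x ^ 3 = 3) →
    ∀ (A B : WeierstrassCurve ℚ) [A.IsElliptic] [A.IsGloballyMinimal] [B.IsElliptic]
      [B.IsGloballyMinimal], (∃ C : VariableChange ℚ, C • B = cubeSumCurve (p : ℚ)) →
      (∃ C : VariableChange ℚ, C • A = cubeSumCurve (3 * (p : ℚ) ^ 2)) →
      ∃ qB qA : ℚ, shaAn B = (qB : ℂ) ∧ shaAn A = (qA : ℂ) ∧ qB * qA ≠ 0 ∧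
        ∃ n : ℕ, padicValRat 2 (qB * qA) = 2 * n)

include hBC

/-- **THE RUNG LEAF ⟺ THE INDEX FORMULA, modulo the cell's `2`-adic index theorem.** Granted the
displayed binder `hBC` (memo two Thm B′/B″ + C in `thm14` currency; NOT in print — see
`…UpperOnV0.lean`) and the facts: `X12.CMAtTwo ⟺` for all members/partners and THE `n` of the binder,
`ord₂ #Ш(B)[2^∞] + ord₂ #Ш(A)[2^∞] = 2 n` — the `2`-part of the Gross–Zagier–Kolyvagin index formula
`#Ш(E_p)·#Ш(E_{3p²}) = 2^{−i} r(p)²` for Hu–Shu–Yin's Heegner point (memo two Thm B′), whose `ℓ`-part is a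
theorem for every odd `ℓ`. [cite: HuShuYin2019, (bsd) p. 12 and Cor. 4.4] [cite: GrossZagier1986, V.§2]
[cite: Miller2011LMS, Def. 1.1] -/
theorem cmAtTwo_iff_indexIdentity_of_twoAdicPair (hF : PublishedFactsTwo) :
    X12.CMAtTwo ↔
      ∀ (p : ℕ), p.Prime → (p % 9 = 4 ∨ p % 9 = 7) → (¬ ∃ x : ZMod p, x ^ 3 = 3) →
        ∀ (A B : WeierstrassCurve ℚ) [A.IsElliptic] [A.IsGloballyMinimal] [B.IsElliptic]
          [B.IsGloballyMinimal], (∃ C : VariableChange ℚ, C • B = cubeSumCurve (p : ℚ)) →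
          (∃ C : VariableChange ℚ, C • A = cubeSumCurve (3 * (p : ℚ) ^ 2)) →
          ∀ (qB qA : ℚ), shaAn B = (qB : ℂ) → shaAn A = (qA : ℂ) →
            ∀ n : ℕ, padicValRat 2 (qB * qA) = 2 * n →
              padicValNat 2 (Nat.card (AddCommGroup.primaryComponent B.sha 2)) +
                padicValNat 2 (Nat.card (AddCommGroup.primaryComponent A.sha 2)) = 2 * n := by
  rw [cmAtTwo_iff_pairIdentity hF]
  refine ⟨fun h p hp h9 h3 A B _ _ _ _ hB hA qB qA hqB hqA n hn => ?_,
    fun h p hp h9 h3 A B _ _ _ _ hB hA => ?_⟩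
  · obtain ⟨qB', qA', hqB', hqA', -, heq⟩ := h p hp h9 h3 A B hB hA
    have hqq : qB' = qB := by exact_mod_cast hqB'.symm.trans hqB
    have hqq' : qA' = qA := by exact_mod_cast hqA'.symm.trans hqA
    subst hqq hqq'
    rw [hn] at heq
    exact_mod_cast heq
  · obtain ⟨qB, qA, hqB, hqA, hne, n, hn⟩ := hBC p hp h9 h3 A B hB hA
    refine ⟨qB, qA, hqB, hqA, hne, ?_⟩
    rw [hn]
    exact_mod_cast h p hp h9 h3 A B hB hA qB qA hqB hqA n hn

/-- **COMPOSITION: the registered stubs of 19476 + the lower twin 19477 + the facts ⇒ the rung leaf.**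
`hBC` = `stub_twoAdicPairHSY`, `hoff` = `stub_indexBoundOffV0HSY` (both displayed; OPEN), `hlo` = item
19477; the bridge is the route's `CMRungInputs.cmAtTwo_of_inputs` fed with
`upperOfFacts_of_twoAdicPair_of_offV0` (p431798). Conditional by construction; credits nothing.
[cite: Miller2011LMS, Def. 1.1] [cite: HuShuYin2019, Thm. 1.4 (p. 3)] -/
theorem cmAtTwo_of_stubs_of_lowerOfFacts
    (hoff : PublishedFactsTwo → ∀ (p : ℕ), p.Prime → (p % 9 = 4 ∨ p % 9 = 7) →
      (¬ ∃ x : ZMod p, x ^ 3 = 3) →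
      ∀ (A B : WeierstrassCurve ℚ) [A.IsElliptic] [A.IsGloballyMinimal] [B.IsElliptic]
        [B.IsGloballyMinimal], (∃ C : VariableChange ℚ, C • B = cubeSumCurve (p : ℚ)) →
        (∃ C : VariableChange ℚ, C • A = cubeSumCurve (3 * (p : ℚ) ^ 2)) →
        ¬ (Nat.card (AddCommGroup.primaryComponent B.sha 2) = 1 ∧
            Nat.card (AddCommGroup.primaryComponent A.sha 2) = 1) →
        MissingUpperBoundAt B 2)
    (hlo : HeegnerIndexLowerAtTwoHSYOfFacts) (hF : PublishedFactsTwo) : X12.CMAtTwo :=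
  Summit.BirchSwinnertonDyer.BirchSwinnertonDyer.Rank1Residual.CMRungInputs.cmAtTwo_of_inputs
    (hlo hF) (upperOfFacts_of_twoAdicPair_of_offV0 hBC hoff hF) hF

end Binder

end Summit.BirchSwinnertonDyer.BirchSwinnertonDyer.Theorems.SylvesterTwoUpper

end
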